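import Summits.ABC.IUTFork.Repair.RHTameBandLicenceMu
import Summits.ABC.IUTFork.Repair.RHSigmaMassGap
import HarnessLib

/-!
# R-H ROUND 2 → MIN-SLICE §(v) / round-3 input (C-i) for ROW 5, AT THE GENUINE BED: «μ(T) = 1» for any stratum is «σ holds every weighing
# cell»; for Σ₅ it is «every bad prime uniformly tame ∧ the TOP cell at each bad place»; and the top cell obeys `ord_v(q_v) ≤ 4·e(v|p)`

Seat abc-iut-rh-typ-5 (R-H PAIR n = 5 TYPER, gen 5; round-2 row-5 hand). PROOF-ONLY companion of `RHTameBandLicenceMu` (§1–§4: tower law, slack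
profile, μ₅ per place) over this seat's `RH.TameBandLicence.Cell` (p458742) / `RH.TameBandLicenceSigma.sigmaFive` (p472055); consumed BY NAME:
abc-iut-rh2-T-1's `RH.SigmaMass` / `RHSigmaMassGap` (`cellTrivialCost`, `offTrivialMass`, `cellTrivialCost_div_le_offTrivialMass`,
`cellTrivialCost_settingPrVolSharp_eq`, `onTrivialMass_settingPrVolSharp_eq_mass`), abc-iut-rh2-w-1's `RHCellWeights(Bed)` (`mass_labelSegment_eq`,
`totalMass_eq_finsum_placeSum`, `qLocal_settingPrVolSharp_labelIndep`), abc-iut-c312-7's `bridgeHyps_settingPrVolSharp_of_ideles` /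
`qLocal_settingPrVolSharp_neg_iff` / `_nonpos`, abc-iut-C-cert's `Cor312Prov.exists_nat_qPilot_pilotDataOfK`. No `def`, no new `Prop`, no instance,
no notation. HONEST FRAMING: nothing here asserts abc proved or refuted; no side is taken on [IUTchIII] Cor. 3.12 or on any author; `sigmaFive` /
`UniformlyTameAt` are READING PREDICATES over OUR typed objects; typed ≠ proved; computed ≠ proved.

WHAT IS PROVED (`X := pilotDataOfK D K`, window setting `settingPrVolSharp X … tq t …` with REALISING Θ- and q-ideles; at a bad place `w ∣ p`:
`v = w ∩ 𝓞_F`, `b = e(v|p) = ramIdx F v`, `Q = ord_v(q_v) = qParamOrd E v`, `P_w = P_q(w) ∈ ℕ`):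
* §5a `RH.SigmaMass.offTrivialMass_eq_zero_iff_forall_mem` (generic: `B_triv(σᶜ) = 0 ⟺ σ ∋` every cell of positive trivial cost);
  §5b `cellTrivialCost_settingPrVolSharp_inr_pos_iff` (the prime cell `(i, p)` weighs `> 0` iff label `≥ 2` and a bad place over `p`; archimedean `0`);
  **`offTrivialMass_settingPrVolSharp_eq_zero_iff`** (ANY σ: «μ(T) = 1 ⟺ σ contains every prime cell of label `≥ 2` over a bad prime» — MIN-SLICE
  §(v-2)'s «μ → 1 ⟺ Σ_data ∩ place → all labels at every bad place» as one kernel sentence); `forall_mem_sigmaFive_inr_iff`;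
  **`offTrivialMass_sigmaFive_eq_zero_iff`** («μ₅(T) = 1 ⟺ every bad prime UNIFORMLY TAME ∧ `Cell e_w P_w l⋆` at each of its bad places»);
  (C-i): **`offTrivialMass_sigmaFive_eq_zero_of_tame_of_qParamOrd_le`** (all bad primes uniformly tame ∧ `ord_v(q_v) ≤ 4·e(v|p)` everywhere ⟹
  μ₅(T) = 1 at EVERY admissible `l`), `not_offTrivialMass_sigmaFive_eq_zero_of_lt_qParamOrd` (one bad place with `ord_v(q_v) ≥ 4e(v|p)+1` kills it from
  `l ≥ 12e(v|p)+3` on), `not_offTrivialMass_sigmaFive_eq_zero_of_not_uniformlyTame` (so does any non-uniformly-tame bad prime — every bad `p ≤ l+1`,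
  scope law p479188). Row 5's L-WINDOW reading: `l_all⁵(T)` exists iff every bad place has `ord_v(q_v) ≤ 4·e(v|p)` (bounded local height) and some
  admissible `l` leaves every bad prime uniformly tame; then μ₅ = 1 on that whole range — numbers, not a rescue.
* §5c **`exists_sliceColumn_onTrivialMass_sigmaFive_eq`** — μ₅ EXPLICIT (MIN-SLICE §(v-1), row 5): a column function `J₅ ≤ l⋆` cutting Σ₅ exactly
  with `mass(Σ₅) = (Σᶠ_{v_ℚ} S(J₅(v_ℚ))·(−qLocal_{1,v_ℚ}))/l⋆`, and `totalTrivialMass_settingPrVolSharp_eq_finsum_placeSum` (`M` likewise with `S(l⋆)`):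
  `μ₅(T) = Σ_v S(J₅(v))·h_v/(S(l⋆)·Σ_v h_v)` (abc-iut-rh2-w-1 `mass_labelSegment_eq` / `totalMass_eq_finsum_placeSum` BY NAME).
[cite: Mochizuki2012, IUTchI Def. 3.1 (b)(c) p. 61–62, Ex. 3.2 (iv) p. 71; IUTchIII Cor. 3.12 Step (xi-f) p. 184; IUTchIV Prop. 1.2 (i)(ii) p. 10]
[cite: DupuyHilado2025, §3.3, §3.4, Thm. 3.10.1] [cite: NeukirchANT1999, Ch. II Prop. (6.8)] [claim: Mochizuki2012, status: disputed]. Axioms: standard.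
-/

noncomputable section
open Set Metric Function NumberField IsDedekindDomain
open scoped Pointwise

/-! ## §5a. Generic: «μ = 1» iff the stratum holds every weighing cell -/

namespace Summit.ABC.IUTFork.Repair.RH.SigmaMass

open Summit.ABC.IUTFork.Thm311 Summit.ABC.IUTFork.Thm311.Real Summit.ABC.IUTFork.Cor312 Summit.ABC.IUTFork.Cor312.Setting
  Summit.ABC.IUTFork.Cor312Vol Summit.ABC.IUTFork.Cor312Prov Literature.IUT.LogThetaLattice Literature.IUT.LogVolume
  Literature.IUT.HodgeTheaters Literature.IUT.LogVolume.ThetaData Summit.ABC.IUTFork.Repair.RH.SigmaLicence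

variable {ι : ThetaIndex} {S : Situation ι} {P : Cor312.Setting S}

/-- **«μ = 1» GENERICALLY: `B_triv(σᶜ) = 0` iff the stratum contains every cell of POSITIVE trivial cost** (bridge hypotheses for the finite
supports; `⟹` is the no-interior bound `cost(c)/l⋇ ≤ B_triv(σᶜ)`, `⟸` is termwise). With `mass(σ) + B_triv(σᶜ) = M` this is MIN-SLICE §(v)'s
«μ(T) = mass(σ)/M = 1». [folklore] -/
theorem offTrivialMass_eq_zero_iff_forall_mem (H : BridgeHyps P) (σ : Set (Fin ι.lstar × ι.VQ)) :
    offTrivialMass P σ = 0 ↔ ∀ c : Fin ι.lstar × ι.VQ, 0 < cellTrivialCost P c → c ∈ σ := by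
  constructor
  · intro h0 c hc
    by_contra hn
    have h := cellTrivialCost_div_le_offTrivialMass H hn
    rw [h0] at h
    have hl : (0 : ℝ) < ι.lstar := by exact_mod_cast lt_of_lt_of_le (by norm_num) ι.two_le_lstar
    rw [div_le_iff₀ hl, zero_mul] at h
    linarith
  · intro hσ
    unfold offTrivialMass
    have h : (fun i : Fin ι.lstar => ∑ᶠ vQ : ι.VQ, σᶜ.indicator (cellTrivialCost P) (i, vQ)) = fun _ => (0 : ℝ) := by
      funext i
      refine finsum_eq_zero_of_forall_eq_zero fun vQ => ?_
      rw [Set.indicator_apply_eq_zero]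
      intro hc
      exact le_antisymm (not_lt.1 fun h => hc (hσ _ h)) (cellTrivialCost_nonneg _)
    rw [h]
    exact processionNormalized_zero

end Summit.ABC.IUTFork.Repair.RH.SigmaMass

namespace Summit.ABC.IUTFork.Repair.RH.TameBandLicenceSigma

open Literature.AnabelianGeometry.AbsoluteAnabelian Literature.IUT.LogThetaLattice Literature.IUT.LogVolume
  Literature.IUT.HodgeTheaters Literature.NumberTheory.NumberFields Literature.NumberTheory.GaloisRepresentations.Ultrametric
open Summit.ABC.IUTFork.Thm311 Summit.ABC.IUTFork.Thm311.Real Summit.ABC.IUTFork.Cor312 Summit.ABC.IUTFork.Cor312.Setting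
  Summit.ABC.IUTFork.Cor312Vol Summit.ABC.IUTFork.Cor312Prov Summit.ABC.IUTFork.Repair.RH.TameBandLicence
  Summit.ABC.IUTFork.Repair.RH.SigmaLicence Summit.ABC.IUTFork.Repair.RH.SigmaMass Summit.ABC.IUTFork.Repair.RH.CellWeights

variable {F K Fbar : Type} [Field F] [NumberField F] [Field K] [NumberField K] [Algebra F K] [Field Fbar]
  [Algebra F Fbar] [Algebra K Fbar] {E : WeierstrassCurve F} [E.IsElliptic] {l : ℕ} {Pb : BadPlacePredicates K}
  (D : InitialThetaData F K Fbar E l Pb)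

/-! ## §5b. «μ(T) = 1» at the window bed, for any stratum and for Σ₅ -/

variable {logv : PadicLogs K} (hlog : LogvAnalytic logv)
  (M : Type) [Field M] [NumberField M]
  (archPk : ∀ (j : (thetaIndex (pilotDataOfK D K)).Label) (vQ : (thetaIndex (pilotDataOfK D K)).VQ),
    Set ((logShellsDH (pilotDataOfK D K) logv).Packet j vQ))
  (archSub : ∀ (j : (thetaIndex (pilotDataOfK D K)).Label) (v : (thetaIndex (pilotDataOfK D K)).V),
    Set ((logShellsDH (pilotDataOfK D K) logv).Packet j ((thetaIndex (pilotDataOfK D K)).over v)))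
  (Ψ : ℤ → ∀ v : (thetaIndex (pilotDataOfK D K)).V, v ∈ (thetaIndex (pilotDataOfK D K)).Vbad →
    Set ((logShellsDH (pilotDataOfK D K) logv).StarPacket v))
  (act : ℤ → ∀ v : (thetaIndex (pilotDataOfK D K)).V, v ∈ (thetaIndex (pilotDataOfK D K)).Vbad →
    (logShellsDH (pilotDataOfK D K) logv).StarPacket v → Module.End ℚ ((logShellsDH (pilotDataOfK D K) logv).StarPacket v))
  (Mmod : ℤ → ∀ j : (thetaIndex (pilotDataOfK D K)).LabelStar, Set ((logShellsDH (pilotDataOfK D K) logv).GlobalPacket j.1))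
  (region : ℤ → ∀ j : (thetaIndex (pilotDataOfK D K)).LabelStar, FinDivisor M → ∀ vQ : (thetaIndex (pilotDataOfK D K)).VQ,
    Set ((logShellsDH (pilotDataOfK D K) logv).Packet j.1 vQ))
  (n : ℤ) {HT : Type} {LogLink : HT → HT → Type} {IsFull : ∀ {s t : HT}, LogLink s t → Prop}
  (lat : LGPGaussianLogThetaLattice LogLink IsFull)
  {Frd : Type} {IsoF : Frd → Frd → Type} {Ob : Frd → Type} {realify : Frd → Frd} {Strip : Type}
  {IsoS : Strip → Strip → Type} {Mv : ∀ v : (thetaIndex (pilotDataOfK D K)).V, v ∈ (thetaIndex (pilotDataOfK D K)).Vbad → Type}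
  [∀ v h, Monoid (Mv v h)]
  (sig : GlobalLGPFrobenioidSignature (thetaIndex (pilotDataOfK D K)).lstar (thetaIndex (pilotDataOfK D K)).V
    (· ∈ (thetaIndex (pilotDataOfK D K)).Vbad) Frd IsoF Ob realify Strip IsoS Mv)
  (split : SplittingMonoids Mv) {ObΔ : Type} {N : ∀ v : (thetaIndex (pilotDataOfK D K)).V, v ∈ (thetaIndex (pilotDataOfK D K)).Vbad → Type}
  [∀ v h, Monoid (N v h)] (qData : QPilotData ObΔ N)
  (tq : ∀ (pp : Nat.Primes) (x : (thetaIndex (pilotDataOfK D K)).Fibre (.inr pp)),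
    haveI : Fact (pp : ℕ).Prime := ⟨pp.2⟩; kOf (pilotDataOfK D K) pp.1 x)
  (t : ∀ (pp : Nat.Primes) (_ : Fin (pilotDataOfK D K).lstar) (x : (thetaIndex (pilotDataOfK D K)).Fibre (.inr pp)),
    haveI : Fact (pp : ℕ).Prime := ⟨pp.2⟩; kOf (pilotDataOfK D K) pp.1 x)
  (htq0 : ∀ pp x, tq pp x ≠ 0)
  (htq1 : ∀ (pp : Nat.Primes) (x : (thetaIndex (pilotDataOfK D K)).Fibre (.inr pp)),
    haveI : Fact (pp : ℕ).Prime := ⟨pp.2⟩; placeOf (pilotDataOfK D K) pp.1 x ∉ (pilotDataOfK D K).S → ‖tq pp x‖ = 1)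
  (ht0 : ∀ pp i x, t pp i x ≠ 0)
  (ht : ∀ (pp : Nat.Primes) (i : Fin (pilotDataOfK D K).lstar) (x : (thetaIndex (pilotDataOfK D K)).Fibre (.inr pp)),
    haveI : Fact (pp : ℕ).Prime := ⟨pp.2⟩
    Real.log ‖t pp i x‖ = -((pilotDataOfK D K).thetaPilot i (placeOf (pilotDataOfK D K) pp.1 x)) *
      logNorm K (placeOf (pilotDataOfK D K) pp.1 x) / localDegree K (placeOf (pilotDataOfK D K) pp.1 x))
  (htq : ∀ (pp : Nat.Primes) (x : (thetaIndex (pilotDataOfK D K)).Fibre (.inr pp)),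
    haveI : Fact (pp : ℕ).Prime := ⟨pp.2⟩
    Real.log ‖tq pp x‖ = -((pilotDataOfK D K).qPilot (placeOf (pilotDataOfK D K) pp.1 x)) *
      logNorm K (placeOf (pilotDataOfK D K) pp.1 x) / localDegree K (placeOf (pilotDataOfK D K) pp.1 x))

/-- The fibre of `V(K) → V_ℚ` over `p` meets `S` iff some `v ∈ V(K)_p` is in `S` (abc-iut-c312-5's `fibreEquivPlacesOver`). [folklore] -/
theorem exists_fibre_mem_S_iff (pp : Nat.Primes) :
    (∃ w : (thetaIndex (pilotDataOfK D K)).Fibre (.inr pp),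
        haveI : Fact (pp : ℕ).Prime := ⟨pp.2⟩; placeOf (pilotDataOfK D K) pp.1 w ∈ (pilotDataOfK D K).S) ↔
      ∃ v ∈ placesOver K (pp : ℕ), v ∈ (pilotDataOfK D K).S := by
  haveI : Fact (pp : ℕ).Prime := ⟨pp.2⟩
  constructor
  · rintro ⟨w, hw⟩
    exact ⟨_, placeOf_mem (pilotDataOfK D K) pp.1 w, hw⟩
  · rintro ⟨v, hv, hS⟩
    refine ⟨(fibreEquivPlacesOver (pilotDataOfK D K) pp).symm ⟨v, hv⟩, ?_⟩
    have h1 : placeOf (pilotDataOfK D K) pp.1 ((fibreEquivPlacesOver (pilotDataOfK D K) pp).symm ⟨v, hv⟩) = v := by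
      change ((fibreEquivPlacesOver (pilotDataOfK D K) pp) ((fibreEquivPlacesOver (pilotDataOfK D K) pp).symm ⟨v, hv⟩)).1 = v
      rw [Equiv.apply_symm_apply]
    rw [h1]
    exact hS

include ht0 ht htq in
/-- **Which cells weigh anything at the bed** (realising ideles): the prime cell `(i, p)` has POSITIVE trivial cost iff its label is `j = i+1 ≥ 2`
AND a bad place lies over `p` (cost `((i+1)²−1)·(−qLocal_{i+1,p})`, `qLocal < 0` exactly over bad primes, c312-7 `qLocal_settingPrVolSharp_neg_iff`).
[cite: DupuyHilado2025, §3.3, Thm. 3.10.1] [claim: Mochizuki2012, status: disputed] -/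
theorem cellTrivialCost_settingPrVolSharp_inr_pos_iff (i : Fin (thetaIndex (pilotDataOfK D K)).lstar) (pp : Nat.Primes) :
    0 < cellTrivialCost (settingPrVolSharp (pilotDataOfK D K) hlog M archPk archSub Ψ act Mmod region n lat sig split qData tq t htq0 htq1)
        (i, Sum.inr pp) ↔
      1 ≤ (i : ℕ) ∧ ∃ w : (thetaIndex (pilotDataOfK D K)).Fibre (.inr pp),
        haveI : Fact (pp : ℕ).Prime := ⟨pp.2⟩; placeOf (pilotDataOfK D K) pp.1 w ∈ (pilotDataOfK D K).S := by
  rw [cellTrivialCost_settingPrVolSharp_eq (pilotDataOfK D K) hlog M archPk archSub Ψ act Mmod region n lat sig split qData tq t htq0 htq1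
    ht0 ht htq (i, .inr pp), exists_fibre_mem_S_iff,
    ← qLocal_settingPrVolSharp_neg_iff (pilotDataOfK D K) hlog M archPk archSub Ψ act Mmod region n lat sig split qData t tq htq0 htq1 htq
      (labelSucc i) pp]
  simp only [Sum.elim_inr]
  have hi0 : (0 : ℝ) ≤ (((i : ℕ) : ℝ) + 1) ^ 2 - 1 := by
    have : (0 : ℝ) ≤ ((i : ℕ) : ℝ) := Nat.cast_nonneg _
    nlinarith
  constructor
  · intro h
    rcases pos_and_pos_or_neg_and_neg_of_mul_pos h with ⟨ha, hq'⟩ | ⟨ha, -⟩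
    · refine ⟨?_, neg_pos.1 hq'⟩
      by_contra hi
      have hi' : ((i : ℕ) : ℝ) = 0 := by exact_mod_cast (show (i : ℕ) = 0 by omega)
      rw [hi'] at ha
      norm_num at ha
    · exact absurd ha (not_lt.2 hi0)
  · rintro ⟨hi, hq'⟩
    have hi' : (1 : ℝ) ≤ ((i : ℕ) : ℝ) := by exact_mod_cast hi
    exact mul_pos (by nlinarith) (neg_pos.2 hq')

include ht0 ht htq in
/-- Archimedean cells cost nothing at the bed. [folklore] -/
theorem cellTrivialCost_settingPrVolSharp_inl (i : Fin (thetaIndex (pilotDataOfK D K)).lstar) (u : Unit) :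
    cellTrivialCost (settingPrVolSharp (pilotDataOfK D K) hlog M archPk archSub Ψ act Mmod region n lat sig split qData tq t htq0 htq1)
      (i, Sum.inl u) = 0 := by
  rw [cellTrivialCost_settingPrVolSharp_eq (pilotDataOfK D K) hlog M archPk archSub Ψ act Mmod region n lat sig split qData tq t htq0 htq1
    ht0 ht htq (i, .inl u)]
  simp only [Sum.elim_inl]

include ht0 ht htq in
/-- **«μ(T) = 1» AT THE BED, ANY STRATUM σ: `B_triv(σᶜ) = 0` iff σ contains every prime cell of label `≥ 2` over a prime under a bad place**
(label `1` and archimedean cells weigh `0`). This is MIN-SLICE §(v-2)'s «μ → 1 ⟺ Σ_data ∩ place → all labels at every bad place», as a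
kernel sentence. [cite: DupuyHilado2025, §3.3, Thm. 3.10.1] [claim: Mochizuki2012, status: disputed] -/
theorem offTrivialMass_settingPrVolSharp_eq_zero_iff
    (σ : Set (Fin (thetaIndex (pilotDataOfK D K)).lstar × (thetaIndex (pilotDataOfK D K)).VQ)) :
    offTrivialMass (settingPrVolSharp (pilotDataOfK D K) hlog M archPk archSub Ψ act Mmod region n lat sig split qData tq t htq0 htq1) σ = 0 ↔
      ∀ (i : Fin (thetaIndex (pilotDataOfK D K)).lstar) (pp : Nat.Primes), 1 ≤ (i : ℕ) →
        (∃ w : (thetaIndex (pilotDataOfK D K)).Fibre (.inr pp),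
          haveI : Fact (pp : ℕ).Prime := ⟨pp.2⟩; placeOf (pilotDataOfK D K) pp.1 w ∈ (pilotDataOfK D K).S) →
        (i, Sum.inr pp) ∈ σ := by
  have ht1 := fun pp i x hx => norm_eq_one_of_realises (pilotDataOfK D K) t ht0 ht pp i x hx
  have H := bridgeHyps_settingPrVolSharp_of_ideles (pilotDataOfK D K) hlog M archPk archSub Ψ act Mmod region n lat sig split qData t tq ht0
    ht1 htq0 htq1
  rw [offTrivialMass_eq_zero_iff_forall_mem H σ]
  constructor
  · intro h i pp hi hbad
    exact h (i, .inr pp) ((cellTrivialCost_settingPrVolSharp_inr_pos_iff D hlog M archPk archSub Ψ act Mmod region n lat sig split qData tq t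
      htq0 htq1 ht0 ht htq i pp).2 ⟨hi, hbad⟩)
  · rintro h ⟨i, vQ⟩ hc
    cases vQ with
    | inl u =>
      rw [cellTrivialCost_settingPrVolSharp_inl D hlog M archPk archSub Ψ act Mmod region n lat sig split qData tq t htq0 htq1 ht0 ht htq i u]
        at hc
      exact absurd hc (lt_irrefl 0)
    | inr pp =>
      obtain ⟨hi, hbad⟩ := (cellTrivialCost_settingPrVolSharp_inr_pos_iff D hlog M archPk archSub Ψ act Mmod region n lat sig split qData
        tq t htq0 htq1 ht0 ht htq i pp).1 hc
      exact h i pp hi hbad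

/-- The top index `l⋆ − 1` (label `j = l⋆`) is a label index. [folklore] -/
theorem lstar_sub_one_lt : (pilotDataOfK D K).lstar - 1 < (thetaIndex (pilotDataOfK D K)).lstar := by
  have := (pilotDataOfK D K).two_le_lstar
  show (pilotDataOfK D K).lstar - 1 < (pilotDataOfK D K).lstar
  omega

/-- **Σ₅'s column over `p` is FULL iff it contains the top label**, iff (no bad place over `p`) or (`p` uniformly tame and the TOP cell
`Cell e_w P_w l⋆` at every bad `w ∣ p`) — `sigmaFive_inr_anti` + `mem_sigmaFive_inr_iff` at `i = l⋆ − 1`. [claim: Mochizuki2012, status: disputed] -/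
theorem forall_mem_sigmaFive_inr_iff (pp : Nat.Primes) :
    (∀ i : Fin (thetaIndex (pilotDataOfK D K)).lstar, (i, Sum.inr pp) ∈ sigmaFive D) ↔
      haveI : Fact (pp : ℕ).Prime := ⟨pp.2⟩
      (∀ w : (thetaIndex (pilotDataOfK D K)).Fibre (.inr pp), placeOf (pilotDataOfK D K) pp.1 w ∉ (pilotDataOfK D K).S) ∨
        (UniformlyTameAt D pp ∧
          ∀ w : (thetaIndex (pilotDataOfK D K)).Fibre (.inr pp), placeOf (pilotDataOfK D K) pp.1 w ∈ (pilotDataOfK D K).S →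
            ∀ P : ℕ, (pilotDataOfK D K).qPilot (placeOf (pilotDataOfK D K) pp.1 w) = P →
              Cell (((placeOf (pilotDataOfK D K) pp.1 w).asIdeal.ramificationIdx ℤ : ℕ) : ℤ) (P : ℤ) ((pilotDataOfK D K).lstar : ℤ)) := by
  haveI : Fact (pp : ℕ).Prime := ⟨pp.2⟩
  set i₀ : Fin (thetaIndex (pilotDataOfK D K)).lstar := ⟨(pilotDataOfK D K).lstar - 1, lstar_sub_one_lt D⟩ with hi₀
  have hl2 := (pilotDataOfK D K).two_le_lstar
  have htop : (((i₀ : ℕ) + 1 : ℕ) : ℤ) = ((pilotDataOfK D K).lstar : ℤ) := by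
    show ((((pilotDataOfK D K).lstar - 1) + 1 : ℕ) : ℤ) = _
    rw [Nat.sub_add_cancel (le_trans one_le_two hl2)]
  constructor
  · intro h
    have h0 := (mem_sigmaFive_inr_iff D i₀ pp).1 (h i₀)
    rwa [htop] at h0
  · intro h i
    have h0 : (i₀, Sum.inr pp) ∈ sigmaFive D := by
      rw [mem_sigmaFive_inr_iff, htop]
      exact h
    exact sigmaFive_inr_anti D pp (Nat.le_sub_one_of_lt i.2) h0

include ht0 ht htq in
/-- **ROW 5: «μ₅(T) = 1» ⟺ EVERY BAD PRIME IS UNIFORMLY TAME AND THE TOP CELL HOLDS AT EACH OF ITS BAD PLACES** (window bed, realising ideles: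
`B_triv(Σ₅ᶜ) = 0` iff for every prime `p` under a bad place, `UniformlyTameAt D p` and `Cell e_w P_w l⋆` at every bad `w ∣ p`). With the scope law
(p479188) and `RHTameBandLicenceMu` §4 this is row 5's (C-i) window in closed form. [cite: Mochizuki2012, IUTchIII Cor. 3.12 Step (xi-f) p. 184;
IUTchIV Prop. 1.2 (i)(ii) p. 10] [cite: DupuyHilado2025, §3.3, §3.4, Thm. 3.10.1] [claim: Mochizuki2012, status: disputed] -/
theorem offTrivialMass_sigmaFive_eq_zero_iff :
    offTrivialMass (settingPrVolSharp (pilotDataOfK D K) hlog M archPk archSub Ψ act Mmod region n lat sig split qData tq t htq0 htq1)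
        (sigmaFive D) = 0 ↔
      ∀ pp : Nat.Primes, haveI : Fact (pp : ℕ).Prime := ⟨pp.2⟩
        (∃ w : (thetaIndex (pilotDataOfK D K)).Fibre (.inr pp), placeOf (pilotDataOfK D K) pp.1 w ∈ (pilotDataOfK D K).S) →
          UniformlyTameAt D pp ∧
            ∀ w : (thetaIndex (pilotDataOfK D K)).Fibre (.inr pp), placeOf (pilotDataOfK D K) pp.1 w ∈ (pilotDataOfK D K).S →
              ∀ P : ℕ, (pilotDataOfK D K).qPilot (placeOf (pilotDataOfK D K) pp.1 w) = P →
                Cell (((placeOf (pilotDataOfK D K) pp.1 w).asIdeal.ramificationIdx ℤ : ℕ) : ℤ) (P : ℤ) ((pilotDataOfK D K).lstar : ℤ) := by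
  rw [offTrivialMass_settingPrVolSharp_eq_zero_iff D hlog M archPk archSub Ψ act Mmod region n lat sig split qData tq t htq0 htq1 ht0 ht htq]
  have hl2 := (pilotDataOfK D K).two_le_lstar
  constructor
  · intro h pp hbad
    haveI : Fact (pp : ℕ).Prime := ⟨pp.2⟩
    have h0 := h ⟨(pilotDataOfK D K).lstar - 1, lstar_sub_one_lt D⟩ pp (by show 1 ≤ (pilotDataOfK D K).lstar - 1; omega) hbad
    have hfull : ∀ i : Fin (thetaIndex (pilotDataOfK D K)).lstar, (i, Sum.inr pp) ∈ sigmaFive D := fun i =>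
      sigmaFive_inr_anti D pp (Nat.le_sub_one_of_lt i.2) h0
    rcases (forall_mem_sigmaFive_inr_iff D pp).1 hfull with hno | hyes
    · obtain ⟨w, hw⟩ := hbad
      exact absurd hw (hno w)
    · exact hyes
  · intro h i pp _ hbad
    exact (forall_mem_sigmaFive_inr_iff D pp).2 (Or.inr (h pp hbad)) i

include ht0 ht htq in
/-- **(C-i) ROW 5, SUFFICIENT: all bad primes uniformly tame and `ord_v(q_v) ≤ 4·e(v|p)` at every bad place ⟹ «μ₅(T) = 1»** (`B_triv(Σ₅ᶜ) = 0`: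
Σ₅ is every cell that weighs anything) — at EVERY admissible `l`; a bounded-local-height condition, not a rescue.
[cite: Mochizuki2012, IUTchI Ex. 3.2 (iv) p. 71; IUTchIV Prop. 1.2 (i)(ii) p. 10] [cite: DupuyHilado2025, §3.3, §3.4] [claim: Mochizuki2012, status: disputed] -/
theorem offTrivialMass_sigmaFive_eq_zero_of_tame_of_qParamOrd_le
    (htame : ∀ pp : Nat.Primes, haveI : Fact (pp : ℕ).Prime := ⟨pp.2⟩
      (∃ w : (thetaIndex (pilotDataOfK D K)).Fibre (.inr pp), placeOf (pilotDataOfK D K) pp.1 w ∈ (pilotDataOfK D K).S) →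
        UniformlyTameAt D pp)
    (hQ : ∀ (pp : Nat.Primes) (w : (thetaIndex (pilotDataOfK D K)).Fibre (.inr pp)), haveI : Fact (pp : ℕ).Prime := ⟨pp.2⟩
      placeOf (pilotDataOfK D K) pp.1 w ∈ (pilotDataOfK D K).S →
        qParamOrd E (finBelow F K (placeOf (pilotDataOfK D K) pp.1 w)) ≤ 4 * ramIdx F (finBelow F K (placeOf (pilotDataOfK D K) pp.1 w))) :
    offTrivialMass (settingPrVolSharp (pilotDataOfK D K) hlog M archPk archSub Ψ act Mmod region n lat sig split qData tq t htq0 htq1)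
      (sigmaFive D) = 0 := by
  rw [offTrivialMass_sigmaFive_eq_zero_iff D hlog M archPk archSub Ψ act Mmod region n lat sig split qData tq t htq0 htq1 ht0 ht htq]
  intro pp hbad
  exact ⟨htame pp hbad, fun w hw P hP => cell_top_pilotDataOfK_of_qParamOrd_le D pp w hw hP (hQ pp w hw)⟩

include ht0 ht htq in
/-- **(C-i) ROW 5, NECESSARY: one bad place with `ord_v(q_v) ≥ 4·e(v|p) + 1` kills «μ₅(T) = 1» from `l ≥ 12·e(v|p) + 3` on** (and so does
any bad prime that is not uniformly tame, e.g. every bad `p ≤ l+1`, p479188). [cite: Mochizuki2012, IUTchI Ex. 3.2 (iv) p. 71; IUTchIV Prop. 1.2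
(i)(ii) p. 10] [cite: DupuyHilado2025, §3.3, §3.4] [claim: Mochizuki2012, status: disputed] -/
theorem not_offTrivialMass_sigmaFive_eq_zero_of_lt_qParamOrd (pp : Nat.Primes)
    (w : (thetaIndex (pilotDataOfK D K)).Fibre (.inr pp))
    (hw : haveI : Fact (pp : ℕ).Prime := ⟨pp.2⟩; placeOf (pilotDataOfK D K) pp.1 w ∈ (pilotDataOfK D K).S)
    (hQ : haveI : Fact (pp : ℕ).Prime := ⟨pp.2⟩
      4 * ramIdx F (finBelow F K (placeOf (pilotDataOfK D K) pp.1 w)) + 1 ≤ qParamOrd E (finBelow F K (placeOf (pilotDataOfK D K) pp.1 w)))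
    (hl : haveI : Fact (pp : ℕ).Prime := ⟨pp.2⟩; 12 * ramIdx F (finBelow F K (placeOf (pilotDataOfK D K) pp.1 w)) + 3 ≤ l) :
    offTrivialMass (settingPrVolSharp (pilotDataOfK D K) hlog M archPk archSub Ψ act Mmod region n lat sig split qData tq t htq0 htq1)
      (sigmaFive D) ≠ 0 := by
  haveI : Fact (pp : ℕ).Prime := ⟨pp.2⟩
  intro h0
  rw [offTrivialMass_sigmaFive_eq_zero_iff D hlog M archPk archSub Ψ act Mmod region n lat sig split qData tq t htq0 htq1 ht0 ht htq] at h0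
  obtain ⟨-, hcells⟩ := h0 pp ⟨w, hw⟩
  obtain ⟨P, hP, -, -⟩ := exists_nat_qPilot_pilotDataOfK D hw
  exact not_cell_top_pilotDataOfK_of_lt_qParamOrd D pp w hw hP hQ hl (hcells w hw P hP)

include ht0 ht htq in
/-- **… and a bad prime that is NOT uniformly tame kills it at every `l`** (its whole column is off Σ₅ while its label-`l⋆` cell weighs `> 0`).
[claim: Mochizuki2012, status: disputed] -/
theorem not_offTrivialMass_sigmaFive_eq_zero_of_not_uniformlyTame (pp : Nat.Primes)
    (hbad : ∃ w : (thetaIndex (pilotDataOfK D K)).Fibre (.inr pp),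
      haveI : Fact (pp : ℕ).Prime := ⟨pp.2⟩; placeOf (pilotDataOfK D K) pp.1 w ∈ (pilotDataOfK D K).S)
    (hnt : ¬ UniformlyTameAt D pp) :
    offTrivialMass (settingPrVolSharp (pilotDataOfK D K) hlog M archPk archSub Ψ act Mmod region n lat sig split qData tq t htq0 htq1)
      (sigmaFive D) ≠ 0 := by
  intro h0
  rw [offTrivialMass_sigmaFive_eq_zero_iff D hlog M archPk archSub Ψ act Mmod region n lat sig split qData tq t htq0 htq1 ht0 ht htq] at h0
  exact hnt (h0 pp hbad).1

/-! ### §5c. μ₅(T) EXPLICIT: `mass(Σ₅) = (Σᶠ_{v_ℚ} S(J₅(v_ℚ))·(−q(v_ℚ)))/l⋆` with `J₅` the slice-boundary column function -/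

include ht0 ht htq in
/-- **μ₅ AS AN EXPLICIT FUNCTION OF THE DATUM (MIN-SLICE §(v-1), row 5, kernel form).** At the window bed with realising ideles a column function
`J₅ : V_ℚ → ℕ`, `J₅ ≤ l⋆`, cuts Σ₅ EXACTLY (`(i, v_ℚ) ∈ Σ₅ ⟺ i+1 ≤ J₅(v_ℚ)`; SLICE (S0) by theorem, `exists_sliceBoundary_sigmaFive`: `J₅ = l⋆` at archimedean
/ bad-place-free packets, `0` at a non-uniformly-tame bad prime, else the least tame cell boundary over the bad `w ∣ p`, clamped to `l⋆`) and
`mass(Σ₅) = (Σᶠ_{v_ℚ} S(J₅(v_ℚ))·(−qLocal_{1,v_ℚ}))/l⋆`, `S(n) = n(n−1)(2n+5)/6` (rh2-w-1 `mass_labelSegment_eq`, rh2-T-1 `onTrivialMass_settingPrVolSharp_eq_mass`);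
against `M = (Σᶠ_{v_ℚ} S(l⋆)·(−qLocal_{1,v_ℚ}))/l⋆` this is `μ₅(T) = Σ_v S(J₅(v))·h_v/(S(l⋆)·Σ_v h_v)` EXACTLY. [cite: DupuyHilado2025, §3.3, §3.9, Thm. 3.10.1]
[claim: Mochizuki2012, status: disputed] -/
theorem exists_sliceColumn_onTrivialMass_sigmaFive_eq :
    ∃ J : (thetaIndex (pilotDataOfK D K)).VQ → ℕ,
      (∀ vQ, J vQ ≤ (pilotDataOfK D K).lstar) ∧
      (∀ (i : Fin (thetaIndex (pilotDataOfK D K)).lstar) (vQ : (thetaIndex (pilotDataOfK D K)).VQ),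
          (i, vQ) ∈ sigmaFive D ↔ (i : ℕ) + 1 ≤ J vQ) ∧
      onTrivialMass (settingPrVolSharp (pilotDataOfK D K) hlog M archPk archSub Ψ act Mmod region n lat sig split qData tq t htq0 htq1)
          (sigmaFive D) =
        (∑ᶠ vQ : (thetaIndex (pilotDataOfK D K)).VQ, (J vQ : ℝ) * (J vQ - 1) * (2 * J vQ + 5) / 6 *
          (-(settingPrVolSharp (pilotDataOfK D K) hlog M archPk archSub Ψ act Mmod region n lat sig split qData tq t htq0 htq1).qLocal
            (labelSucc ⟨0, lt_of_lt_of_le Nat.zero_lt_two (pilotDataOfK D K).two_le_lstar⟩) vQ)) / (pilotDataOfK D K).lstar := by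
  classical
  set P₀ := settingPrVolSharp (pilotDataOfK D K) hlog M archPk archSub Ψ act Mmod region n lat sig split qData tq t htq0 htq1 with hP₀
  set i₀ : Fin (thetaIndex (pilotDataOfK D K)).lstar := ⟨0, lt_of_lt_of_le Nat.zero_lt_two (pilotDataOfK D K).two_le_lstar⟩ with hi₀
  -- the column function: `l⋆` at archimedean packets, the clamped slice boundary at prime packets
  let J : (thetaIndex (pilotDataOfK D K)).VQ → ℕ := fun vQ =>
    Sum.elim (fun _ : Unit => (pilotDataOfK D K).lstar)
      (fun pp : Nat.Primes => min (Classical.choose (exists_sliceBoundary_sigmaFive D pp)) (pilotDataOfK D K).lstar) vQ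
  have hJle : ∀ vQ, J vQ ≤ (pilotDataOfK D K).lstar := by
    rintro (u | pp)
    · exact le_rfl
    · exact min_le_right _ _
  have hJmem : ∀ (i : Fin (thetaIndex (pilotDataOfK D K)).lstar) (vQ : (thetaIndex (pilotDataOfK D K)).VQ),
      (i, vQ) ∈ sigmaFive D ↔ (i : ℕ) + 1 ≤ J vQ := by
    rintro i (u | pp)
    · have hi : (i : ℕ) < (pilotDataOfK D K).lstar := i.2
      exact ⟨fun _ => by show (i : ℕ) + 1 ≤ (pilotDataOfK D K).lstar; omega, fun _ => mem_sigmaFive_inl D i u⟩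
    · have hspec := Classical.choose_spec (exists_sliceBoundary_sigmaFive D pp) i
      have hi : (i : ℕ) < (pilotDataOfK D K).lstar := i.2
      refine hspec.trans ?_
      show (i : ℕ) < Classical.choose (exists_sliceBoundary_sigmaFive D pp) ↔
        (i : ℕ) + 1 ≤ min (Classical.choose (exists_sliceBoundary_sigmaFive D pp)) (pilotDataOfK D K).lstar
      rw [le_min_iff]
      omega
  refine ⟨J, hJle, hJmem, ?_⟩
  rw [onTrivialMass_settingPrVolSharp_eq_mass (pilotDataOfK D K) hlog M archPk archSub Ψ act Mmod region n lat sig split qData tq t htq0 htq1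
    ht0 ht htq (sigmaFive D)]
  exact mass_labelSegment_eq P₀
    (fun i vQ => qLocal_settingPrVolSharp_labelIndep (pilotDataOfK D K) hlog M archPk archSub Ψ act Mmod region n lat sig split qData tq t
      htq0 htq1 htq i i₀ vQ)
    hJle (sigmaFive D) hJmem

include ht0 ht htq in
/-- **… and the total in the same currency**: `M = (Σᶠ_{v_ℚ} S(l⋆)·(−qLocal_{1,v_ℚ}))/l⋆` at the bed (rh2-w-1 `totalMass_eq_finsum_placeSum`, rh2-T-1's
`totalTrivialMass` via `cellTrivialCost_settingPrVolSharp_eq_pilotGapWeight`). [cite: DupuyHilado2025, §3.3, Thm. 3.10.1] [claim: Mochizuki2012, status: disputed] -/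
theorem totalTrivialMass_settingPrVolSharp_eq_finsum_placeSum :
    totalTrivialMass (settingPrVolSharp (pilotDataOfK D K) hlog M archPk archSub Ψ act Mmod region n lat sig split qData tq t htq0 htq1) =
      (∑ᶠ vQ : (thetaIndex (pilotDataOfK D K)).VQ, ((pilotDataOfK D K).lstar : ℝ) * ((pilotDataOfK D K).lstar - 1) *
          (2 * (pilotDataOfK D K).lstar + 5) / 6 *
        (-(settingPrVolSharp (pilotDataOfK D K) hlog M archPk archSub Ψ act Mmod region n lat sig split qData tq t htq0 htq1).qLocal
          (labelSucc ⟨0, lt_of_lt_of_le Nat.zero_lt_two (pilotDataOfK D K).two_le_lstar⟩) vQ)) / (pilotDataOfK D K).lstar := by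
  unfold totalTrivialMass
  rw [cellTrivialCost_settingPrVolSharp_eq_pilotGapWeight (pilotDataOfK D K) hlog M archPk archSub Ψ act Mmod region n lat sig split qData tq t
    htq0 htq1 ht0 ht htq]
  exact totalMass_eq_finsum_placeSum _
    (fun i vQ => qLocal_settingPrVolSharp_labelIndep (pilotDataOfK D K) hlog M archPk archSub Ψ act Mmod region n lat sig split qData tq t
      htq0 htq1 htq i _ vQ)

end Summit.ABC.IUTFork.Repair.RH.TameBandLicenceSigma

end
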